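import Mathlib
import Literature.Claims.NS.ClayVariants
import HarnessLib

/-!
# CLAIM C27 — M. Z. Zgurovsky & P. O. Kasyanov, «Existence of Strong Solutions for the 3D
# Navier-Stokes System» (arXiv:1207.3290 [math.AP])

VERSION TYPED: **v1 (2012-07-13, 7 pp.)** — the only text (TeX `ZgurKas.tex`, 542 lines, and the PDF
page texts `store-text-1207.3290-pages/p0001–p0007`, in `run/shared/lean/pub/ns-claims/sources/
ZgurovskyKasyanov2012/`, LOCATORS by ns-claims-lit-3; locators = the paper's numbers + TeX lines).
**v2 (2012-09-03) is a withdrawal stub: «This paper has been withdrawn by the author due to a crucial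
error»** (no locator given). Bib key `ZgurovskyKasyanov2012`.

WHAT THIS FILE IS: a step-wise typing, at the paper's own grain, of the CLAIMED proof (Galerkin
approximations with the special basis of the Stokes operator, a-priori bounds uniform in `m` on the
whole interval `[0,T]`) that 3D Navier–Stokes on a BOUNDED smooth domain with Dirichlet condition has a
unique global strong solution for every `y₀ ∈ V`, `f ∈ L²_loc(ℝ₊;H)` (Theorem 2.1), smooth for smooth
data (Corollaries 2.2, 2.3), and of the §4 sentence asserting that this «provides the solution of
Problem (A) and … (B)» of [Fef]. The headline is the `def` `ClaimedTheorem`; each printed load-bearing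
assertion is a `def Step… : Prop`; `claim_of_steps` (PROVED) composes them as the paper does; the §4
sentence is the glue Step `Step6_ClayPassage` (= the Clay delta), with `clay_of_claimed_of_step6`.

WHAT THIS IS NOT: not a claim about NS regularity or blow-up; not an endorsement of any Step; not a
claim about any statement of the authors beyond the typed locators of v1.

## Claimed statements (as printed)

* Setting §1 l.80–96 (1.1): `Ω ⊂ ℝ³` bounded open with sufficiently smooth boundary,
  `y_t + (y·∇)y = νΔy − ∇p + f` in `Ω × (0,T)`, `div y = 0`, `y = 0` on `∂Ω × (0,T)`, `y(x,0) = y₀(x)`;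
  `𝒱 = {u ∈ C₀^∞(Ω)³ : div u = 0}`, `H`, `V`, `b(u,v,w) = ∫_Ω Σ u_i ∂_i v_j w_j` with «`b(u,v,v) = 0`»
  (l.97–105); weak (Leray–Hopf) solutions (1.2)–(1.4); Stokes operator `A`, `D(A) = H² ∩ V` (l.150–163);
  strong = weak ∩ Serrin class `L⁸(0,T;L⁴)` (l.171–177).
* **Theorem 2.1** (l.190–198): «Let `f ∈ L²_loc(ℝ₊;H)` and `y₀ ∈ V`. Then there exists an unique weak
  solution `y(·)` of Pr. (1.1) on `[0,+∞)`. Moreover, `y(·) ∈ C(ℝ₊;V) ∩ L²_loc(ℝ₊;D(A))` and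
  `dy/dt ∈ L²_loc(ℝ₊;H)`, i.e., `y(·)` is a strong global solution of Pr. (1.1) on `[0,+∞)`.»
* **Corollary 2.3** (l.467–473): `Ω` a `C^∞`-domain, `f ≡ 0`, `y₀ ∈ C₀^∞(Ω)` ⇒ the strong solution
  satisfies `y ∈ C^∞([0,+∞) × Ω̄)³`, `p ∈ C^∞`. (Corollary 2.2, l.444–451: `f ∈ C₀^∞`, smooth in `(0,∞) × Ω`.)
* **§4** (l.483–486): «In a standard way Corollary 2.3 provides the solution of Problem (A) and with
  minor technical modification the solution of Problem (B) from [Fef].»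

## Architecture of the printed proof of Theorem 2.1 and ordered Step index

Reduction (l.200–201, [KTZ Thm 2.2]) to `f ∈ C¹(ℝ₊;H)`, `y₀ ∈ D(A)`; Galerkin approximations `y_m` in the
special basis (2.2)–(2.3); standard bounds (2.4) on `[0,T+1]`, (2.5)–(2.6) on `[0,δ]` ([Temam Ch. III]).
* `Step0_Ineq21`            — (2.1) l.180–186: `|b(u,v,ω)| ≤ C‖u‖_V^{1/2}‖u‖_H^{1/2}‖v‖_{D(A)}‖ω‖_H` ([Sell p.365]; true).
* `Step1_DerivBound`        — **Step 1** (2.7) l.231–324: `‖y_m'(t)‖_H ≤ c₃` on `[0,δ]`, uniformly in `m`.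
* `Step2a_TrilinearIdentity`— **Step 2, the displayed identity l.345–348: «`b(u,u,ω) − b(v,v,ω) = b(u+v,u−v,ω)`
                              `∀ u,v,ω ∈ V`»** — used to make the trilinear term of the difference
                              `y_m(t+h) − y_m(t)` vanish (l.349–360). (By trilinearity the left side is
                              `b(u,u−v,ω) + b(u−v,v,ω)`; the printed right side is `b(u,u,ω) − b(u,v,ω) +
                              b(v,u,ω) − b(v,v,ω)`.)
* `Step2_LipschitzH`        — **Step 2** (2.10) l.325–390: `‖y_m(t+h) − y_m(t)‖_H ≤ c₆h` for ALL `t ∈ [0,T]`, `h ∈ (0,δ)`, `m`.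
* `Step3_UniformV`          — **Step 3** (2.11) l.391–431: `‖y_m(t)‖_V ≤ c₇` for all `m`, `t ∈ [0,T]` (from (2.12)–(2.13)).
* `Step4_Limit`             — **Step 4** l.432–441: the bounds ⇒ limit `y` is a strong solution on `[0,T]`, unique ⇒ Theorem 2.1.
* `Step5_Smoothness`        — Corollaries 2.2/2.3 l.444–473 via [Sohr Thm 1.8.2] (smoothness of strong solutions).
* `Step6_ClayPassage`       — §4 l.483–486 (the glue to (A)/(B)).

TYPING NOTE. The functional-analytic objects (`H`, `V = H¹₀ ∩ {div = 0}`, `A`, the special basis) are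
not in the tree; the Galerkin Steps 1–4 are therefore typed over an explicit hypothesis structure
`Galerkin` (basis, eigen-relation, Galerkin system (2.2)–(2.3) written with the concrete integrals
`ipH`, `ipV`, `bform` over `Ω`), the data in the smooth sub-classes the reduction l.200–201 allows
(`f` smooth, `y₀ ∈ 𝒱`), and the conclusions of Theorem 2.1 / Corollary 2.3 in the classical (smooth)
category — every such narrowing makes the typed statements WEAKER than printed. The identity
`Step2a_TrilinearIdentity` and the inequality `Step0_Ineq21` are typed CONCRETELY (integrals over `Ω`).

## Clay delta (reference `Literature/Claims/NS/ClayVariants.lean`)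

Nearest: (A)/(B), but only through §4. Δ1 DOMAIN: the theorem is on a bounded domain with Dirichlet
condition — neither `ℝ³` nor `𝕋³`; the passage is one printed sentence («in a standard way», «minor
technical modification») with no argument ⇒ `clay_of_claimed` is NOT provable; the exact missing bridge
is `Step6_ClayPassage` itself (wrong-problem Δ1 locator candidate). Other axes: force `f ≡ 0` in Cor 2.3
«=»; data `C₀^∞(Ω)` vs (4)/(8) (different domain); solution class `C^∞([0,∞) × Ω̄)` «=» in kind;
horizon `[0,∞)` «=»; `ν > 0` arbitrary «=».
-/

open Set Function MeasureTheory Filter Topology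
open scoped ContDiff ENNReal NNReal Laplacian

namespace Literature.Claims.NS.ZgurovskyKasyanov2012

open Literature.Analysis.FluidPDE

/-! ## Vocabulary (concrete) -/

/-- `ℝ³`. [cite: ZgurovskyKasyanov2012, §1 l.80–82] -/
abbrev E3 : Type := EuclideanSpace ℝ (Fin 3)

/-- Coordinate vector `e_i`. [cite: ZgurovskyKasyanov2012, §1 l.97–103] -/
noncomputable def e (i : Fin 3) : E3 := EuclideanSpace.single i (1 : ℝ)

/-- A bounded `C^∞`-domain: `Ω = {ρ < 0}` for a smooth defining function with non-degenerate gradient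
on `{ρ = 0}`, `Ω` bounded (the paper's «bounded open set with sufficiently smooth boundary», l.80–82;
Corollaries 2.2/2.3: «`C^∞`-domain»). [cite: ZgurovskyKasyanov2012, §1 l.80–82, Cor 2.3 l.467–468] -/
def IsSmoothDomain (Ω : Set E3) : Prop :=
  Bornology.IsBounded Ω ∧ ∃ ρ : E3 → ℝ, ContDiff ℝ (⊤ : ℕ∞) ρ ∧ Ω = {x | ρ x < 0} ∧
    ∀ x, ρ x = 0 → gradient ρ x ≠ 0

/-- `u ∈ 𝒱 = {u ∈ C₀^∞(Ω)³ : div u = 0}` (l.97–98). [cite: ZgurovskyKasyanov2012, §1 l.97–98] -/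
def InCalV (Ω : Set E3) (u : E3 → E3) : Prop :=
  ContDiff ℝ (⊤ : ℕ∞) u ∧ HasCompactSupport u ∧ tsupport u ⊆ Ω ∧ NSWave0.IsDivFree u

/-- A smooth surrogate of `V = {u ∈ H¹₀(Ω)³ : div u = 0}` (l.99–100): continuous fields, `C¹` on `Ω`, vanishing
outside `Ω` (hence on `∂Ω`), divergence free on `Ω`, with `∇u ∈ L²(Ω)` (contains `𝒱`; used only to quantify the trilinear
statements, which the paper states «for all `u,v,ω ∈ V`»). [cite: ZgurovskyKasyanov2012, §1 l.99–100] -/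
def InV (Ω : Set E3) (u : E3 → E3) : Prop :=
  Continuous u ∧ ContDiffOn ℝ 1 u Ω ∧ (∀ x, x ∉ Ω → u x = 0) ∧
    (∀ x ∈ Ω, VectorCalculus.divergence u x = 0) ∧ ∫⁻ x in Ω, ‖fderiv ℝ u x‖ₑ ^ 2 < ⊤

/-- `(u,v) = ∫_Ω u·v` (the `H` inner product, l.106–110). [cite: ZgurovskyKasyanov2012, §1 l.106–110] -/
noncomputable def ipH (Ω : Set E3) (u v : E3 → E3) : ℝ := ∫ x in Ω, @inner ℝ E3 _ (u x) (v x)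

/-- `((u,v)) = ∫_Ω Σ_i ∂_i u · ∂_i v` (the `V` inner product, l.106–110).
[cite: ZgurovskyKasyanov2012, §1 l.106–110] -/
noncomputable def ipV (Ω : Set E3) (u v : E3 → E3) : ℝ :=
  ∫ x in Ω, ∑ i : Fin 3, @inner ℝ E3 _ (fderiv ℝ u x (e i)) (fderiv ℝ v x (e i))

/-- `‖u‖_H` (l.106–110). [cite: ZgurovskyKasyanov2012, §1 l.106–110] -/
noncomputable def normH (Ω : Set E3) (u : E3 → E3) : ℝ := Real.sqrt (ipH Ω u u)

/-- `‖u‖_V` (l.106–110). [cite: ZgurovskyKasyanov2012, §1 l.106–110] -/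
noncomputable def normV (Ω : Set E3) (u : E3 → E3) : ℝ := Real.sqrt (ipV Ω u u)

/-- The `D(A)`-norm rendered by the `H²`-seminorm (l.160–163: «we assume `‖Au‖_H` as the norm on `D(A)`,
which is equivalent to the one induced by `(H²(Ω))³`»; constants are absorbed in the Steps' `∃ C`).
[cite: ZgurovskyKasyanov2012, §1 l.160–163] -/
noncomputable def normDA (Ω : Set E3) (u : E3 → E3) : ℝ :=
  Real.sqrt (∫ x in Ω, ∑ i : Fin 3, ∑ k : Fin 3, ‖iteratedFDeriv ℝ 2 u x ![e i, e k]‖ ^ 2)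

/-- The trilinear form `b(u,v,w) = ∫_Ω Σ_{i,j} u_i (∂_i v_j) w_j dx = ∫_Ω ((u·∇)v)·w` (l.100–103).
[cite: ZgurovskyKasyanov2012, §1 l.100–103] -/
noncomputable def bform (Ω : Set E3) (u v w : E3 → E3) : ℝ :=
  ∫ x in Ω, @inner ℝ E3 _ (convect u v x) (w x)

/-- `∂ₜu(t,x)` (two-sided; Galerkin coefficients are `C²` in `t`, l.262). [cite: ZgurovskyKasyanov2012, Step 1 l.262–264] -/
noncomputable def tderiv (u : ℝ → E3 → E3) (t : ℝ) (x : E3) : E3 := deriv (fun s => u s x) t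

/-- GALERKIN DATA of the proof of Theorem 2.1 (hypothesis structure; l.200–228): a bounded `C^∞`-domain,
`ν > 0`, horizon `T`, the `δ ∈ (0,1)` of (2.5)–(2.6); the reduced data `f ∈ C¹(ℝ₊;H)` (here: `C¹`,
with values in the class `InV`) and `y₀ ∈ D(A)` (here: `y₀ ∈ 𝒱`); the special basis `{ω_j} ⊂ D(A)`,
`Aω_j = λ_jω_j`, `0 < λ₁ ≤ λ₂ ≤ … → ∞`, orthonormal and total in `H` ([Temam1 p.56]); the Galerkin
approximations `y_m : [0,T+1] → span{ω_j}_{j<m}`, `C²` in `t`, solving (2.2) with (2.3); and the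
standard bounds (2.4) (`‖y_m(t)‖_H ≤ c₀` on `[0,T+1]`), (2.5) (`‖y_m(t)‖_V ≤ c₁` on `[0,δ]`), (2.6)
(`∫₀^δ‖y_m‖²_{D(A)} ≤ c₂`) «cf. [Temam, Chapter III]». [cite: ZgurovskyKasyanov2012, proof of Thm 2.1 l.200–228, (2.2)–(2.6)] -/
structure Galerkin (Ω : Set E3) (ν T δ : ℝ) (f : ℝ → E3 → E3) (y₀ : E3 → E3) (w : ℕ → E3 → E3)
    (lam : ℕ → ℝ) (y : ℕ → ℝ → E3 → E3) : Prop where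
  dom : IsSmoothDomain Ω
  nu_pos : 0 < ν
  T_pos : 0 < T
  delta_pos : 0 < δ
  delta_lt_one : δ < 1
  f_smooth : ContDiffOn ℝ 1 (uncurry f) (Ici 0 ×ˢ univ)
  f_mem : ∀ t, 0 ≤ t → InV Ω (f t)
  data : InCalV Ω y₀
  basis_mem : ∀ j, InV Ω (w j) ∧ ContDiffOn ℝ 2 (w j) Ω
  basis_orth : ∀ i j, ipH Ω (w i) (w j) = if i = j then 1 else 0
  basis_eig : ∀ j v, InV Ω v → ipV Ω (w j) v = lam j * ipH Ω (w j) v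
  lam_pos : ∀ j, 0 < lam j
  lam_mono : Monotone lam
  lam_unbounded : Tendsto lam atTop atTop
  basis_total : ∀ v, InV Ω v → (∀ j, ipH Ω v (w j) = 0) → ∀ x ∈ Ω, v x = 0
  span : ∀ m t, ∃ c : Fin m → ℝ, y m t = fun x => ∑ j : Fin m, c j • w j x
  c2 : ∀ m x, ContDiff ℝ 2 (fun t => y m t x)
  galerkin : ∀ m, ∀ j < m, ∀ t ∈ Icc 0 (T + 1),
    deriv (fun s => ipH Ω (y m s) (w j)) t + ν * ipV Ω (y m t) (w j) +
      bform Ω (y m t) (y m t) (w j) = ipH Ω (f t) (w j)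
  init : ∀ m, ∀ j < m, ipH Ω (y m 0) (w j) = ipH Ω y₀ (w j)
  bound24 : ∃ c₀ : ℝ, ∀ m, ∀ t ∈ Icc 0 (T + 1), normH Ω (y m t) ≤ c₀
  bound25 : ∃ c₁ : ℝ, ∀ m, ∀ t ∈ Icc 0 δ, normV Ω (y m t) ≤ c₁
  bound26 : ∃ c₂ : ℝ, ∀ m, ∫ t in Icc 0 δ, normDA Ω (y m t) ^ 2 ≤ c₂

/-- STRONG SOLUTION on `[0,T]` in the classical rendering used here for the conclusion of Theorem 2.1
with smooth data (`y ∈ C(ℝ₊;V) ∩ L²_loc(ℝ₊;D(A))`, `dy/dt ∈ L²_loc(ℝ₊;H)`; strong solutions with smooth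
data are classical for `t > 0`): the equations (1.1) pointwise on `(0,T] × Ω`, `div y = 0`, `y = 0`
off `Ω` (Dirichlet), `y(0) = y₀` with `L²`-continuity at `0`, `sup_{[0,T]}‖y(t)‖_V < ∞`,
`∫₀ᵀ‖y‖²_{D(A)} < ∞`. [cite: ZgurovskyKasyanov2012, Thm 2.1 l.190–198, §1 l.171–177] -/
structure StrongOn (Ω : Set E3) (ν T : ℝ) (f : ℝ → E3 → E3) (y₀ : E3 → E3) (y : ℝ → E3 → E3)
    (p : ℝ → E3 → ℝ) : Prop where
  reg : ∀ t ∈ Ioc 0 T, ContDiffOn ℝ 2 (y t) Ω ∧ ContDiffOn ℝ 1 (p t) Ω ∧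
    ∀ x ∈ Ω, DifferentiableAt ℝ (fun s => y s x) t
  eq : ∀ t ∈ Ioc 0 T, ∀ x ∈ Ω,
    tderiv y t x + convect (y t) (y t) x = ν • Δ (y t) x - gradient (p t) x + f t x
  divFree : ∀ t ∈ Ioc 0 T, ∀ x ∈ Ω, VectorCalculus.divergence (y t) x = 0
  bc : ∀ t ∈ Ioc 0 T, Continuous (y t) ∧ ∀ x, x ∉ Ω → y t x = 0
  ic : y 0 = y₀ ∧ Tendsto (fun t => ipH Ω (y t - y₀) (y t - y₀)) (𝓝[>] 0) (𝓝 0)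
  boundV : ∃ C : ℝ, ∀ t ∈ Icc 0 T, normV Ω (y t) ≤ C
  boundDA : ∫⁻ t in Ioc 0 T, ENNReal.ofReal (normDA Ω (y t) ^ 2) < ⊤

/-! ## Steps, in the order of the printed proof -/

/-- **Step 0 — the trilinear inequality (2.1) l.180–186:** «there exists a constant `C > 0` (cf. [Sell,
p. 365]) such that `|b(u,v,ω)| ≤ C‖u‖_V^{1/2}‖u‖_H^{1/2}‖v‖_{D(A)}‖ω‖_H` `∀ u ∈ V, v ∈ D(A), ω ∈ H`»
(here on the smooth surrogates; the `D(A)`-norm by the `H²`-seminorm). True (Sobolev/Poincaré); typed for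
completeness as the input of Step 1. [cite: ZgurovskyKasyanov2012, (2.1) l.180–186] -/
def Step0_Ineq21 : Prop :=
  ∀ Ω : Set E3, IsSmoothDomain Ω → ∃ C : ℝ, 0 ≤ C ∧ ∀ u v z : E3 → E3,
    InV Ω u → InV Ω v → ContDiffOn ℝ 2 v Ω → InV Ω z →
      |bform Ω u v z| ≤ C * normV Ω u ^ (1 / 2 : ℝ) * normH Ω u ^ (1 / 2 : ℝ) * normDA Ω v * normH Ω z

/-- **Step 1′ — «Consider usual Galerkin approximations» (l.200–228):** for the reduced data the special
basis and the Galerkin approximations on `[0,T+1]` with the standard bounds (2.4)–(2.6) exist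
([Temam Ch. III], [Temam1 p. 56]). Classical; typed as the existence of `Galerkin` data.
[cite: ZgurovskyKasyanov2012, proof of Thm 2.1 l.200–228] -/
def Step1pre_GalerkinExists : Prop :=
  ∀ (Ω : Set E3), IsSmoothDomain Ω → ∀ ν : ℝ, 0 < ν → ∀ T : ℝ, 0 < T →
    ∀ (f : ℝ → E3 → E3), ContDiffOn ℝ 1 (uncurry f) (Ici 0 ×ˢ univ) → (∀ t, 0 ≤ t → InV Ω (f t)) →
    ∀ (y₀ : E3 → E3), InCalV Ω y₀ →
      ∃ (δ : ℝ) (w : ℕ → E3 → E3) (lam : ℕ → ℝ) (y : ℕ → ℝ → E3 → E3), Galerkin Ω ν T δ f y₀ w lam y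

/-- **Step 1 — (2.7) l.231–324:** «There exists a constant `c₃ > 0` such that `‖(d/dt)y_m(t)‖_H ≤ c₃`
`∀ m ≥ 1`, `∀ t ∈ [0,δ]`» (via (2.1), the differentiated Galerkin system, (2.8)–(2.9), Gronwall with
(2.6)). [cite: ZgurovskyKasyanov2012, Step 1 (2.7)–(2.9) l.231–324] -/
def Step1_DerivBound : Prop :=
  ∀ (Ω : Set E3) (ν T δ : ℝ) (f : ℝ → E3 → E3) (y₀ : E3 → E3) (w : ℕ → E3 → E3) (lam : ℕ → ℝ)
    (y : ℕ → ℝ → E3 → E3), Galerkin Ω ν T δ f y₀ w lam y →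
      ∃ c₃ : ℝ, ∀ m, ∀ t ∈ Icc 0 δ, normH Ω (tderiv (y m) t) ≤ c₃

/-- **Step 2a — THE DISPLAYED IDENTITY of Step 2, l.345–348:** «As `b(u,u,ω) − b(v,v,ω) = b(u+v,u−v,ω)`
`∀ u,v,ω ∈ V`, then direct calculations provide …» — used (l.349–360) to write the Galerkin system for
`y_m(t+h) − y_m(t)` with the trilinear term `b(y_m(t+h)+y_m(t), y_m(t+h)−y_m(t), ω_j)`, which vanishes
when tested with the difference itself. Typed concretely for the paper's `b` on the fields of `V`
(smooth surrogate). [cite: ZgurovskyKasyanov2012, Step 2 l.345–348] -/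
def Step2a_TrilinearIdentity : Prop :=
  ∀ Ω : Set E3, IsSmoothDomain Ω → ∀ u v z : E3 → E3, InV Ω u → InV Ω v → InV Ω z →
    bform Ω u u z - bform Ω v v z = bform Ω (u + v) (u - v) z

/-- **Step 2 — (2.10) l.325–390:** «There exists a constant `c₆ > 0` such that `‖y_m(t+h) − y_m(t)‖_H
≤ c₆h` `∀ m ≥ 1`, `∀ t ∈ [0,T]`, `∀ h ∈ (0,δ)`» (printed proof: the difference system via Step 2a, the
energy inequality with `λ₁`, then `‖y_m(h) − y_m(0)‖_H ≤ c₃h` by Step 1 and `f ∈ C¹`).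
[cite: ZgurovskyKasyanov2012, Step 2 (2.10) l.325–390] -/
def Step2_LipschitzH : Prop :=
  ∀ (Ω : Set E3) (ν T δ : ℝ) (f : ℝ → E3 → E3) (y₀ : E3 → E3) (w : ℕ → E3 → E3) (lam : ℕ → ℝ)
    (y : ℕ → ℝ → E3 → E3), Galerkin Ω ν T δ f y₀ w lam y →
      ∃ c₆ : ℝ, ∀ m, ∀ t ∈ Icc 0 T, ∀ h ∈ Ioo 0 δ, normH Ω (y m (t + h) - y m t) ≤ c₆ * h

/-- **Step 3 — (2.11) l.391–431:** «There exists `c₇ > 0` such that `‖y_m(t)‖_V ≤ c₇` `∀ m ≥ 1`,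
`∀ t ∈ [0,T]`» (from the energy identity, (2.12), and (2.13) which uses (2.4) and (2.10); then
`ν∫_t^{t+h}‖y_m‖²_V ≤ (c₀c₆ + c₈)h` and continuity). Typed as the printed implication from (2.10).
[cite: ZgurovskyKasyanov2012, Step 3 (2.11)–(2.13) l.391–431] -/
def Step3_UniformV : Prop :=
  ∀ (Ω : Set E3) (ν T δ : ℝ) (f : ℝ → E3 → E3) (y₀ : E3 → E3) (w : ℕ → E3 → E3) (lam : ℕ → ℝ)
    (y : ℕ → ℝ → E3 → E3), Galerkin Ω ν T δ f y₀ w lam y →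
      (∃ c₆ : ℝ, ∀ m, ∀ t ∈ Icc 0 T, ∀ h ∈ Ioo 0 δ, normH Ω (y m (t + h) - y m t) ≤ c₆ * h) →
        ∃ c₇ : ℝ, ∀ m, ∀ t ∈ Icc 0 T, normV Ω (y m t) ≤ c₇

/-- **Step 4 — l.432–441:** «Estimation (2.11) straightforwardly provides that `{y_m}` is bounded
sequence in `L^∞(0,T;V) ∩ L²(0,T;D(A))` and `{dy_m/dt}` is bounded in `L²(0,T;H)`. In a standard way we
get that the limit function `y` of `y_m`, `m → +∞`, is a strong solution of Pr. (1.1) on `[0,T]`. Due to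
[Serrin], [Temam Ch. 3] it is unique …». Typed as the printed implication from (2.11) to a strong
solution on `[0,T]`. [cite: ZgurovskyKasyanov2012, Step 4 l.432–441] -/
def Step4_Limit : Prop :=
  ∀ (Ω : Set E3) (ν T δ : ℝ) (f : ℝ → E3 → E3) (y₀ : E3 → E3) (w : ℕ → E3 → E3) (lam : ℕ → ℝ)
    (y : ℕ → ℝ → E3 → E3), Galerkin Ω ν T δ f y₀ w lam y →
      (∃ c₇ : ℝ, ∀ m, ∀ t ∈ Icc 0 T, normV Ω (y m t) ≤ c₇) →
        ∃ (ys : ℝ → E3 → E3) (p : ℝ → E3 → ℝ), StrongOn Ω ν T f y₀ ys p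

/-- **Theorem 2.1** (l.190–198) in the smooth-data rendering allowed by the reduction l.200–201
(«it is enough to consider the case, when `f ∈ C¹(ℝ₊;H)` and `y₀ ∈ D(A)`»): for every bounded
`C^∞`-domain, `ν > 0`, such `f`, `y₀ ∈ 𝒱`, and every `T > 0`, a strong solution on `[0,T]` (uniqueness,
printed, is not repeated — omitting it weakens the typed claim). [cite: ZgurovskyKasyanov2012, Thm 2.1 l.190–201] -/
def Theorem21 : Prop :=
  ∀ (Ω : Set E3), IsSmoothDomain Ω → ∀ ν : ℝ, 0 < ν →
    ∀ (f : ℝ → E3 → E3), ContDiffOn ℝ 1 (uncurry f) (Ici 0 ×ˢ univ) → (∀ t, 0 ≤ t → InV Ω (f t)) →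
    ∀ (y₀ : E3 → E3), InCalV Ω y₀ → ∀ T : ℝ, 0 < T →
      ∃ (ys : ℝ → E3 → E3) (p : ℝ → E3 → ℝ), StrongOn Ω ν T f y₀ ys p

/-- **Corollary 2.3** (l.467–473): «Let `Ω` be a `C^∞`-domain, `f ≡ 0`. Then for any `y₀ ∈ C₀^∞(Ω)`
there exists an unique strong solution `y` of Pr. (1.1) on `[0,+∞)`. Moreover `y ∈ C^∞([0,+∞) × Ω̄)³`,
`p ∈ C^∞([0,+∞) × Ω̄)`» (divergence-freeness of `y₀`, implicit in `y₀ ∈ V`, made explicit).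
[cite: ZgurovskyKasyanov2012, Cor 2.3 l.467–473] -/
def Corollary23 : Prop :=
  ∀ (Ω : Set E3), IsSmoothDomain Ω → ∀ ν : ℝ, 0 < ν → ∀ (y₀ : E3 → E3), InCalV Ω y₀ →
    ∃ (ys : ℝ → E3 → E3) (p : ℝ → E3 → ℝ),
      (∀ T : ℝ, 0 < T → StrongOn Ω ν T (0 : ℝ → E3 → E3) y₀ ys p) ∧
      ContDiffOn ℝ (⊤ : ℕ∞) (uncurry ys) (Ici 0 ×ˢ closure Ω) ∧
      ContDiffOn ℝ (⊤ : ℕ∞) (uncurry p) (Ici 0 ×ˢ closure Ω)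

/-- **Step 5 — Corollaries 2.2/2.3, l.444–473:** smoothness of the strong solution for smooth data «in a
standard way (see, for example, [Sohr, Theorem 1.8.2, p.300])». Typed as the printed implication
Theorem 2.1 ⇒ Corollary 2.3. [cite: ZgurovskyKasyanov2012, Cor 2.2–2.3 l.444–473] -/
def Step5_Smoothness : Prop := Theorem21 → Corollary23

/-- **Step 6 — §4 «Navier-Stokes System in ℝ³», l.483–486 (the Clay glue, = the Clay delta Δ1):** «In a
standard way Corollary 2.3 provides the solution of Problem (A) and with minor technical modification
the solution of Problem (B) from [Fef].» No argument is printed; typed as the implication exactly as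
asserted. [cite: ZgurovskyKasyanov2012, §4 l.483–486] -/
def Step6_ClayPassage : Prop :=
  Corollary23 → ClayVariants.clayR3.Regularity ∧ ClayVariants.clayPeriodic.Regularity

/-! ## The claimed theorem, composition, Clay link -/

/-- THE CLAIMED THEOREM: Theorem 2.1 (global strong solutions on bounded smooth domains) with its
Corollary 2.3 (smoothness up to `t = 0` for `f ≡ 0`, `y₀ ∈ C₀^∞`). A `def`, never a `theorem`.
[cite: ZgurovskyKasyanov2012, Thm 2.1 l.190–198, Cor 2.3 l.467–473] -/
def ClaimedTheorem : Prop := Theorem21 ∧ Corollary23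

/-- COMPOSITION (PROVED) in the paper's own order: Galerkin data (Step 1′) → Step 2 (using Step 1 and
the identity Step 2a in print) gives (2.10) on `[0,T]` → Step 3 gives (2.11) → Step 4 the strong
solution ⇒ Theorem 2.1; Step 5 ⇒ Corollary 2.3. Steps 0, 1, 2a are the printed inputs of Steps 1, 2
and are carried as hypotheses. [cite: ZgurovskyKasyanov2012, proof of Thm 2.1 l.199–442] -/
theorem claim_of_steps (_h0 : Step0_Ineq21) (h1pre : Step1pre_GalerkinExists) (_h1 : Step1_DerivBound)
    (_h2a : Step2a_TrilinearIdentity) (h2 : Step2_LipschitzH) (h3 : Step3_UniformV) (h4 : Step4_Limit)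
    (h5 : Step5_Smoothness) : ClaimedTheorem := by
  have h21 : Theorem21 := by
    intro Ω hΩ ν hν f hf hfV y₀ hy₀ T hT
    obtain ⟨δ, w, lam, y, hG⟩ := h1pre Ω hΩ ν hν T hT f hf hfV y₀ hy₀
    exact h4 Ω ν T δ f y₀ w lam y hG (h3 Ω ν T δ f y₀ w lam y hG (h2 Ω ν T δ f y₀ w lam y hG))
  exact ⟨h21, h5 h21⟩

/-- Under the printed §4 sentence (Step 6), the claimed theorem would yield Fefferman's (A) and (B).
Recorded, not asserted: `Step6_ClayPassage` is the Clay delta (Δ1 domain), unproved in the paper.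
[cite: ZgurovskyKasyanov2012, §4 l.483–486] -/
theorem clay_of_claimed_of_step6 (h6 : Step6_ClayPassage) (h : ClaimedTheorem) :
    ClayVariants.clayR3.Regularity ∧ ClayVariants.clayPeriodic.Regularity :=
  h6 h.2

end Literature.Claims.NS.ZgurovskyKasyanov2012
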